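import Literature.Barriers.CriticalPhenomena.PositionSpaceRGNonGibbsianSpacingSelectionProofs
import Literature.Probability.LatticeModels.IsingPeierlsFlip
import Literature.Probability.LatticeModels.StarLattice
import HarnessLib

/-!
# Barrier `PositionSpaceRGNonGibbsian`, Theorem 4.3: the Peierls condition for the internal spins
# under decimation with spacing `b` (van Enter–Fernández–Sokal 1993, App. B.5.3) — proved

Companion file on the Theorem 4.3 line of
`Literature/Barriers/CriticalPhenomena/PositionSpaceRGNonGibbsian.lean`. What is left of Theorem 4.3
is the named fact `VEFS1993_plusPhase` for spacings `b ≥ 3` (`…Thm43Reduction.lean`): the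
low-temperature `+` phase of the internal-spin system with fully alternating image spins, which the
source obtains from Pirogov–Sinai theory (§4.3.2) once "these ground states satisfy the Peierls
condition" (App. B.5.3). This file proves that Peierls condition — the zero-temperature, purely
combinatorial input of the Pirogov–Sinai (or any contour / chessboard) argument — in the following
form.

## What the source prints (arXiv:hep-lat/9210032, App. B.5.3, pp. 236–240)

"Consider then the (internal-spin) configuration `ω_Γ` obtained by inserting a '`+`' (internal-spin)
contour `Γ` inside the configuration `ω^{(+)}`, that is, a region of '`-`' bounded by `Γ`. Its
relative energy can be written in the form `H(ω_Γ | ω^{(+)}) = 2J|Γ| - ΔE_- + ΔE_+` (B.71), where `|Γ|`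
is the area of the contour [number of plaquettes …], `ΔE_-` is the energy gain due to the fact that
the '`-`' image spins inside of, or visited by, `Γ` acquire '`-`' neighbors, and `ΔE_+` is the
additional energy due to '`+`' image spins in `Γ`. To prove the Peierls condition we have to check
that the extra contribution `ΔE_- - ΔE_+` is proportional to the area of the contour with a not too
large proportionality constant. The intuition is clear: The contributions corresponding to '`+`' and
'`-`' image spins inside the volume cancel each other, except possibly for a layer of image spins
placed close to the contour." (p. 237); "The internal-spin contours are obtained from the
original-spin contours by removing the plaquettes adjacent to an image spin" (p. 236); the
cancellation "by sweeping in order along" a coordinate axis (p. 239); the conclusion (B.75)–(B.77):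
`H(ω_Γ | ω^{(+)}) ≥ 2J(1 - M_{d,b})|Γ|`, `M_{d,b} = max(1/(2d-1), d/(2(d-1)(b-1)))` (B.78), "Formulas
(B.75) and (B.76) show both that the configurations `ω^{(+)}` and `ω^{(-)}` are indeed the only
periodic ground-state configurations and that the Peierls condition is satisfied for the
internal-spin system with Peierls constant `ρ₀ ≥ 2J(1 - M_{d,b})`" (p. 240).

## What is formalised (namespace `Literature.Barriers.CriticalPhenomena.NonGibbs`), all proved

For every spacing `b ≥ 2` (the case with content being `b ≥ 3`: for `b = 2` the alternating fields
cancel exactly, §4.3.1 Step 1), dimension `d ≥ 2`, a configuration `ξ` of frozen image spins in which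
**every `-` image spin has `+` image spins at the `2d` next image sites along the axes** (`MinusIsolated`;
the fully alternating configuration `p·ω'_alt` of §4.3.2, and the boundary conditions
`signedCoreAnnulusBC d b p R' R' 1 1` of `VEFS1993_plusPhase` — alternating on `Λ_{R'}`, `+` outside —
are such, `minusIsolated_signedCoreAnnulusBC`), and a finite set `M` of internal sites (the region of
`-` internal spins inserted into `ω^{(+)}`):

* `minusInc ξ M`, `plusInc ξ M` — the pairs (internal site of `M`, adjacent `∓` image spin): their
  numbers are `ΔE₋ / 2J` and `ΔE₊ / 2J`; `ffBdryPairs M` — the pairs (site of `M`, adjacent internal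
  site outside `M`): their number is the area `|Γ|` of the internal-spin contour.
* **`two_mul_card_minusInc_le`**: `2·#minusInc ≤ 2·#plusInc + #ffBdryPairs`, i.e.
  `ΔE_- - ΔE_+ ≤ J|Γ|`, i.e. `H(ω_Γ | ω^{(+)}) ≥ J|Γ|`: the Peierls estimate of (B.75)–(B.77) with the
  constant `1/2` in place of `M_{d,b}` (weaker than the printed constant for large `d`, `b`, equal
  to it at `(d,b) = (2,3)`; any constant `< 1` is a Peierls condition). Proof (a rigorous version of
  the sweeping argument of p. 239): a `-` image spin `a` with a neighbour `u = a + s eⱼ ∈ M` is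
  CANCELLED against the `+` image spin `a + s b eⱼ` when the latter's neighbour `a + s(b-1)eⱼ` lies
  in `M` (an injection `minusInc → plusInc`); otherwise the segment `a + s t eⱼ`, `1 ≤ t ≤ b-1`,
  leaves `M` at a first `t₀ ≥ 2`, and the pair receives TWO boundary pairs of `M`: the axial exit
  `(a + s(t₀-1)eⱼ, a + s t₀ eⱼ)` and one of three pairs next to it in a fixed lateral direction
  `eᵢ`, `i ≠ j`; all these boundary pairs are distinct (they are told apart by their direction and
  by the number of coordinates not divisible by `b` of their endpoints, and a segment site determines
  its image spin up to the excluded `±b eⱼ`).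
* `two_mul_card_minusInc_filter_le` — the LOCAL form (as used contour by contour): the `-`
  incidences at a set `S` of image spins are paid by the `+` incidences and boundary pairs within
  sup-distance `b` of `S` (`plusIncNear`, `ffBdryPairsNear`; `supDist_axialPartner_le`, `supDist_bdryPair_le`).
* `sum_imgField_ge` — the same in the language of the tree's image fields
  (`imgField`, `…SpacingSelectionProofs.lean`): `-∑_{u ∈ M} h^ξ_u ≤ #ffBdryPairs / 2`.
* `isingHamiltonian_flipOn_plusFill_sub` — the identity (B.71) for the tree's Hamiltonian:
  `H^ζ_Λ(ω_Γ) - H^ζ_Λ(ω^{(+)}) = 2(|Γ| + ∑_{y ∈ M} h^ζ_y)` (`plusFill ζ` = `ω^{(+)}`, `ω_Γ` its flip on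
  `M ⊆ Λ`), and the energy form of the Peierls condition
  `card_ffBdryPairs_le_isingHamiltonian_flipOn_sub`: `H^ζ_Λ(ω_Γ) - H^ζ_Λ(ω^{(+)}) ≥ |Γ|` (units `J = 1`),
  specialised to the boundary conditions of `VEFS1993_plusPhase`
  (`card_ffBdryPairs_le_isingHamiltonian_flipOn_sub_signedCoreAnnulusBC`).

Nothing is asserted: the file is sorry-free and introduces no named fact (D-0014, D-0026).

## References

* A. C. D. van Enter, R. Fernández, A. D. Sokal, J. Stat. Phys. 72 (1993) 879–1167,
  arXiv:hep-lat/9210032 — §4.3.2 and App. B.5.3, eqs. (B.71)–(B.78) [VanenterFernandezSokal1993].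
-/

noncomputable section

namespace Literature.Barriers.CriticalPhenomena.NonGibbs

open Finset Literature.Probability.LatticeModels

variable {d : ℕ}

/-! ### Lattice preliminaries: unit steps, coordinates not divisible by `b` -/

section Lattice

variable {b : ℕ}

/-- The value of `a + c • eⱼ` at a coordinate. [folklore] -/
theorem add_zsmul_single_apply (a : Site d) (c : ℤ) (j i : Fin d) :
    (a + c • (Pi.single j (1 : ℤ) : Site d)) i = a i + if i = j then c else 0 := by
  simp only [Pi.add_apply, Pi.smul_apply, Pi.single_apply, smul_eq_mul, mul_ite, mul_one, mul_zero]

/-- A unit step is an edge of `ℤ^d`: `x ∼ x + s eⱼ` for `s = ±1`. [cite: FriedliVelenik2017, §3.1] -/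
theorem zdGraph_adj_add_zsmul_single (x : Site d) (j : Fin d) {s : ℤ} (hs : s = 1 ∨ s = -1) :
    (zdGraph d).Adj x (x + s • (Pi.single j (1 : ℤ) : Site d)) := by
  rw [zdGraph_adj_iff]
  rcases hs with rfl | rfl
  · exact ⟨j, Or.inl (by rw [one_smul])⟩
  · refine ⟨j, Or.inr ?_⟩
    funext i
    simp only [Pi.add_apply, Pi.smul_apply, Pi.single_apply, smul_eq_mul]
    split_ifs <;> ring

/-- Every edge of `ℤ^d` is a unit step: `a ∼ u` iff `u = a + s eⱼ` with `s = ±1`.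
[cite: FriedliVelenik2017, §3.1] -/
theorem exists_axisSign_of_adj {a u : Site d} (h : (zdGraph d).Adj a u) :
    ∃ js : Fin d × ℤ, (js.2 = 1 ∨ js.2 = -1) ∧ u = a + js.2 • (Pi.single js.1 (1 : ℤ) : Site d) := by
  obtain ⟨i, h | h⟩ := (zdGraph_adj_iff a u).1 h
  · exact ⟨(i, 1), Or.inl rfl, by rw [one_smul]; exact h⟩
  · refine ⟨(i, -1), Or.inr rfl, ?_⟩
    rw [h]
    funext k
    simp only [Pi.add_apply, Pi.smul_apply, Pi.single_apply, smul_eq_mul]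
    split_ifs <;> ring

variable (b) in
/-- The coordinates of a site NOT divisible by `b` (image sites have none, the internal sites on
the axial segments between image sites have exactly one, their lateral neighbours two).
[cite: VanenterFernandezSokal1993, App. B.5.3] -/
def nmCoords (x : Site d) : Finset (Fin d) := univ.filter fun i => ¬ (b : ℤ) ∣ x i

/-- Membership in `nmCoords`. [folklore] -/
theorem mem_nmCoords {x : Site d} {i : Fin d} : i ∈ nmCoords b x ↔ ¬ (b : ℤ) ∣ x i := by
  simp [nmCoords]

/-- Image sites have no coordinate indivisible by `b`. [cite: VanenterFernandezSokal1993, §3.1.2 eq. (3.7)] -/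
theorem nmCoords_eq_empty_of_isSpImageSite {x : Site d} (hx : IsSpImageSite d b x) :
    nmCoords b x = ∅ := by
  ext i; simp [mem_nmCoords, hx i]

/-- A site with a coordinate indivisible by `b` is internal. [cite: VanenterFernandezSokal1993, §3.1.2] -/
theorem not_isSpImageSite_of_mem_nmCoords {x : Site d} {i : Fin d} (hi : i ∈ nmCoords b x) :
    ¬ IsSpImageSite d b x := fun hx => (mem_nmCoords.1 hi) (hx i)

/-- **Axial segment sites have exactly one coordinate indivisible by `b`**: for an image site `a`
and `c` not divisible by `b`, `nmCoords (a + c eⱼ) = {j}`. [cite: VanenterFernandezSokal1993, App. B.5.3] -/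
theorem nmCoords_add_zsmul_single {a : Site d} (ha : IsSpImageSite d b a) (j : Fin d) {c : ℤ}
    (hc : ¬ (b : ℤ) ∣ c) : nmCoords b (a + c • (Pi.single j (1 : ℤ) : Site d)) = {j} := by
  ext i
  rw [mem_nmCoords, mem_singleton, add_zsmul_single_apply]
  by_cases hij : i = j
  · subst hij
    simp only [if_true, iff_true]
    intro hdvd
    exact hc (by simpa using dvd_sub hdvd (ha i))
  · simp only [hij, if_false, add_zero, iff_false, not_not]
    exact ha i

/-- **Their lateral neighbours have exactly two**: for an image site `a`, `c` not divisible by `b`,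
`i ≠ j` and `b ≥ 2`, `nmCoords (a + c eⱼ + eᵢ) = {j, i}`. [cite: VanenterFernandezSokal1993, App. B.5.3] -/
theorem nmCoords_add_zsmul_single_add_single (hb : 2 ≤ b) {a : Site d} (ha : IsSpImageSite d b a)
    {j i : Fin d} (hij : i ≠ j) {c : ℤ} (hc : ¬ (b : ℤ) ∣ c) :
    nmCoords b (a + c • (Pi.single j (1 : ℤ) : Site d) + (Pi.single i (1 : ℤ) : Site d)) = {j, i} := by
  have hb1 : ¬ (b : ℤ) ∣ 1 := by
    intro h
    have := Int.le_of_dvd one_pos h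
    omega
  ext k
  rw [mem_nmCoords, mem_insert, mem_singleton, Pi.add_apply, add_zsmul_single_apply, Pi.single_apply]
  by_cases hkj : k = j
  · subst hkj
    simp only [if_true, if_neg (Ne.symm hij), add_zero, true_or, iff_true]
    intro hdvd
    exact hc (by simpa using dvd_sub hdvd (ha k))
  · by_cases hki : k = i
    · subst hki
      simp only [if_neg hkj, if_true, add_zero, or_true, iff_true]
      intro hdvd
      exact hb1 (by simpa using dvd_sub hdvd (ha k))
    · simp only [hkj, hki, if_false, add_zero, or_self, iff_false, not_not]
      exact ha k

/-- **A segment site determines its image spin and its offset up to a multiple of `b` along the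
axis**: if `a + c eⱼ = a' + c' e_{j'}` with `a, a'` image sites and `c, c'` not divisible by `b`,
then `j = j'` and `a' = a + (c - c') eⱼ` (so `b ∣ c - c'`).
[cite: VanenterFernandezSokal1993, App. B.5.3] -/
theorem eq_of_add_zsmul_single_eq {a a' : Site d} (ha : IsSpImageSite d b a) (ha' : IsSpImageSite d b a')
    {j j' : Fin d} {c c' : ℤ} (hc : ¬ (b : ℤ) ∣ c) (hc' : ¬ (b : ℤ) ∣ c')
    (heq : a + c • (Pi.single j (1 : ℤ) : Site d) = a' + c' • (Pi.single j' (1 : ℤ) : Site d)) :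
    j = j' ∧ a' = a + (c - c') • (Pi.single j (1 : ℤ) : Site d) := by
  have hjj : j = j' := by
    have h1 := nmCoords_add_zsmul_single ha j hc
    rw [heq, nmCoords_add_zsmul_single ha' j' hc'] at h1
    exact (singleton_injective h1).symm
  subst hjj
  refine ⟨rfl, funext fun i => ?_⟩
  have := congrFun heq i
  rw [add_zsmul_single_apply, add_zsmul_single_apply] at this
  rw [add_zsmul_single_apply]
  split_ifs at this ⊢ with h
  · linarith
  · linarith

/-- Consequently `b` divides the difference of the offsets. [cite: VanenterFernandezSokal1993, App. B.5.3] -/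
theorem dvd_sub_of_add_zsmul_single_eq {a a' : Site d} (ha : IsSpImageSite d b a)
    (ha' : IsSpImageSite d b a') {j j' : Fin d} {c c' : ℤ} (hc : ¬ (b : ℤ) ∣ c) (hc' : ¬ (b : ℤ) ∣ c')
    (heq : a + c • (Pi.single j (1 : ℤ) : Site d) = a' + c' • (Pi.single j' (1 : ℤ) : Site d)) :
    (b : ℤ) ∣ c - c' := by
  obtain ⟨rfl, ha'eq⟩ := eq_of_add_zsmul_single_eq ha ha' hc hc' heq
  have := ha' j
  rw [ha'eq, add_zsmul_single_apply, if_pos rfl] at this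
  simpa using dvd_sub this (ha j)

/-- Translating an image site by `b` along an axis gives an image site.
[cite: VanenterFernandezSokal1993, §4.3.2 ("periodic")] -/
theorem isSpImageSite_add_zsmul_single {a : Site d} (ha : IsSpImageSite d b a) (j : Fin d) {c : ℤ}
    (hc : (b : ℤ) ∣ c) : IsSpImageSite d b (a + c • (Pi.single j (1 : ℤ) : Site d)) := by
  intro i
  rw [add_zsmul_single_apply]
  split_ifs
  · exact dvd_add (ha i) hc
  · simpa using ha i

/-- An offset `c` with `0 < |c| < b`, as it occurs on the axial segments, is not divisible by `b`.
[folklore] -/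
theorem not_dvd_of_abs_lt {c : ℤ} (h0 : c ≠ 0) (hlt : |c| < b) : ¬ (b : ℤ) ∣ c := by
  intro h
  have := Int.le_of_dvd (abs_pos.2 h0) ((dvd_abs _ _).2 h)
  omega

end Lattice

/-! ### The frozen image spins: `-` image spins are isolated along the axes -/

section Pins

variable {b : ℕ}

variable (d b) in
/-- **Isolation of the `-` image spins**: every image site carrying a `-` spin has `+` spins at the
`2d` image sites `a ± b eⱼ` next to it along the axes — the property of the fully alternating
configuration (of either parity) used in the cancellation "for each line in the left-right direction
… look for the next image spin … of opposite sign" (App. B.5.3, p. 239), and preserved when the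
image spins outside a cube are all set to `+`. [cite: VanenterFernandezSokal1993, App. B.5.3] -/
def MinusIsolated (ξ : SpinConfig (Site d)) : Prop :=
  ∀ a : Site d, IsSpImageSite d b a → ξ a = -1 → ∀ (j : Fin d) (s : ℤ), (s = 1 ∨ s = -1) →
    ξ (a + (s * b) • (Pi.single j (1 : ℤ) : Site d)) = 1

/-- `ω'_alt` flips along `± eⱼ` (either sign). [cite: VanenterFernandezSokal1993, eq. (4.2)] -/
theorem altConfig_add_zsmul_single (x : Site d) (j : Fin d) {s : ℤ} (hs : s = 1 ∨ s = -1) :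
    altConfig d (x + s • (Pi.single j (1 : ℤ) : Site d)) = -altConfig d x := by
  rcases hs with rfl | rfl
  · rw [one_smul, altConfig_add_single]
  · have : x = x + (-1 : ℤ) • (Pi.single j (1 : ℤ) : Site d) + Pi.single j 1 := by
      rw [neg_one_smul, neg_add_cancel_right]
    conv_rhs => rw [this, altConfig_add_single]
    rw [neg_neg]

/-- **The boundary conditions of `VEFS1993_plusPhase` have isolated `-` image spins**: with all
image spins of `Λ_{R'}` alternating (parity `p`) and `+` elsewhere, a `-` image spin `bx` has
`x ∈ Λ_{R'}` with `p·ω'_alt(x) = -1`, and `b(x ± eⱼ)` carries `p·ω'_alt(x ± eⱼ) = +1` if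
`x ± eⱼ ∈ Λ_{R'}` and `+1` anyway otherwise. [cite: VanenterFernandezSokal1993, §4.3.2 and App. B.5.3] -/
theorem minusIsolated_signedCoreAnnulusBC (hb : 0 < b) (p : ℤˣ) (R' : ℕ) :
    MinusIsolated d b (signedCoreAnnulusBC d b p R' R' 1 1) := by
  classical
  intro a ha hneg j s hs
  have hb' : (b : ℤ) ≠ 0 := by exact_mod_cast hb.ne'
  -- `a = b x`
  set x : Site d := fun i => a i / b with hx
  have hax : a = fun i => (b : ℤ) * x i := eq_mul_ediv_of_isSpImageSite ha
  have hval := signedCoreAnnulusBC_apply_image (d := d) hb p R' R' 1 1 x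
  rw [← hax] at hval
  rw [hval] at hneg
  -- the translate `a + s b eⱼ = b (x + s eⱼ)`
  have htr : a + (s * b) • (Pi.single j (1 : ℤ) : Site d) =
      fun i => (b : ℤ) * (x + s • (Pi.single j (1 : ℤ) : Site d)) i := by
    funext i
    rw [add_zsmul_single_apply, add_zsmul_single_apply, congrFun hax i]
    split_ifs <;> ring
  rw [htr, signedCoreAnnulusBC_apply_image (d := d) hb p R' R' 1 1]
  by_cases hxR : x ∈ box d R'
  · rw [if_pos hxR] at hneg
    by_cases hx' : x + s • (Pi.single j (1 : ℤ) : Site d) ∈ box d R'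
    · rw [if_pos hx', altConfig_add_zsmul_single x j hs, mul_neg, hneg, neg_neg]
    · rw [if_neg hx', if_neg hx']
  · rw [if_neg hxR, if_neg hxR] at hneg
    exact absurd hneg (by decide)

end Pins

/-! ### Incidences of `M` with `∓` image spins, and boundary pairs of `M` -/

section Objects

variable {b : ℕ}

variable (d b) in
/-- **The `-` incidences of `M`**: pairs `⟨u, a⟩` with `u ∈ M` and `a` an image neighbour of `u`
carrying a `-` image spin (each is a bond that becomes satisfied when the internal spins of `M` are
turned to `-`: their number is `ΔE₋ / 2J` in (B.71)). [cite: VanenterFernandezSokal1993, App. B.5.3 eq. (B.71)] -/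
def minusInc (ξ : SpinConfig (Site d)) (M : Finset (Site d)) : Finset (Σ _ : Site d, Site d) :=
  M.sigma fun u => (imgNbrs d b u).filter fun a => ξ a = -1

variable (d b) in
/-- **The `+` incidences of `M`**: pairs `⟨u, a⟩` with `u ∈ M` and `a` an image neighbour of `u`
carrying a `+` image spin (bonds that become frustrated: their number is `ΔE₊ / 2J` in (B.71)).
[cite: VanenterFernandezSokal1993, App. B.5.3 eq. (B.71)] -/
def plusInc (ξ : SpinConfig (Site d)) (M : Finset (Site d)) : Finset (Σ _ : Site d, Site d) :=
  M.sigma fun u => (imgNbrs d b u).filter fun a => ξ a = 1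

variable (d b) in
/-- **The boundary pairs of `M` among internal sites**: pairs `(u, w)` with `u ∈ M`, `w ∉ M`
internal and `u ∼ w` — the plaquettes of the internal-spin contour `Γ` bounding `M` ("obtained from
the original-spin contours by removing the plaquettes adjacent to an image spin"); their number is
the area `|Γ|`. [cite: VanenterFernandezSokal1993, App. B.5.3 (p. 236) and eq. (B.71)] -/
def ffBdryPairs (M : Finset (Site d)) : Finset (Site d × Site d) :=
  (M ×ˢ M.biUnion fun u => (zdGraph d).neighborFinset u).filter
    fun x => x.2 ∉ M ∧ ¬ IsSpImageSite d b x.2 ∧ (zdGraph d).Adj x.1 x.2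

/-- Membership in `minusInc`. [cite: VanenterFernandezSokal1993, App. B.5.3 eq. (B.71)] -/
theorem mem_minusInc {ξ : SpinConfig (Site d)} {M : Finset (Site d)} {x : Σ _ : Site d, Site d} :
    x ∈ minusInc d b ξ M ↔ x.1 ∈ M ∧ x.2 ∈ imgNbrs d b x.1 ∧ ξ x.2 = -1 := by
  simp only [minusInc, mem_sigma, mem_filter]

/-- Membership in `plusInc`. [cite: VanenterFernandezSokal1993, App. B.5.3 eq. (B.71)] -/
theorem mem_plusInc {ξ : SpinConfig (Site d)} {M : Finset (Site d)} {x : Σ _ : Site d, Site d} :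
    x ∈ plusInc d b ξ M ↔ x.1 ∈ M ∧ x.2 ∈ imgNbrs d b x.1 ∧ ξ x.2 = 1 := by
  simp only [plusInc, mem_sigma, mem_filter]

/-- Membership in `ffBdryPairs`. [cite: VanenterFernandezSokal1993, App. B.5.3 (p. 236)] -/
theorem mem_ffBdryPairs {M : Finset (Site d)} {x : Site d × Site d} :
    x ∈ ffBdryPairs d b M ↔ x.1 ∈ M ∧ x.2 ∉ M ∧ ¬ IsSpImageSite d b x.2 ∧ (zdGraph d).Adj x.1 x.2 := by
  simp only [ffBdryPairs, mem_filter, mem_product, mem_biUnion, SimpleGraph.mem_neighborFinset]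
  constructor
  · rintro ⟨⟨h1, -⟩, h2, h3, h4⟩
    exact ⟨h1, h2, h3, h4⟩
  · rintro ⟨h1, h2, h3, h4⟩
    exact ⟨⟨h1, x.1, h1, h4⟩, h2, h3, h4⟩

/-- `#minusInc = ∑_{u ∈ M} #{a ∼ u image : ξ_a = -1}`. [cite: VanenterFernandezSokal1993, App. B.5.3 eq. (B.71)] -/
theorem card_minusInc (ξ : SpinConfig (Site d)) (M : Finset (Site d)) :
    #(minusInc d b ξ M) = ∑ u ∈ M, #((imgNbrs d b u).filter fun a => ξ a = -1) :=
  card_sigma _ _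

/-- `#plusInc = ∑_{u ∈ M} #{a ∼ u image : ξ_a = +1}`. [cite: VanenterFernandezSokal1993, App. B.5.3 eq. (B.71)] -/
theorem card_plusInc (ξ : SpinConfig (Site d)) (M : Finset (Site d)) :
    #(plusInc d b ξ M) = ∑ u ∈ M, #((imgNbrs d b u).filter fun a => ξ a = 1) :=
  card_sigma _ _

/-- **The image field summed over `M` is `#plusInc - #minusInc`** (`h^ξ_u = ∑_{a ∼ u image} ξ_a`).
[cite: VanenterFernandezSokal1993, §4.3.2 and App. B.5.3 eq. (B.71)] -/
theorem sum_imgField_eq (ξ : SpinConfig (Site d)) (M : Finset (Site d)) :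
    ∑ u ∈ M, imgField d b ξ u = (#(plusInc d b ξ M) : ℝ) - #(minusInc d b ξ M) := by
  rw [card_plusInc, card_minusInc, Nat.cast_sum, Nat.cast_sum, ← sum_sub_distrib]
  refine sum_congr rfl fun u _ => ?_
  unfold imgField
  rw [← sum_filter_add_sum_filter_not (imgNbrs d b u) (fun a => ξ a = 1)]
  have h1 : ∑ a ∈ (imgNbrs d b u).filter (fun a => ξ a = 1), spinAt a ξ =
      #((imgNbrs d b u).filter fun a => ξ a = 1) := by
    rw [card_eq_sum_ones, Nat.cast_sum, Nat.cast_one]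
    refine sum_congr rfl fun a ha => ?_
    simp [spinAt, (mem_filter.1 ha).2]
  have hset : (imgNbrs d b u).filter (fun a => ¬ ξ a = 1) = (imgNbrs d b u).filter fun a => ξ a = -1 := by
    refine filter_congr fun a _ => ?_
    rcases Int.units_eq_one_or (ξ a) with h | h <;> simp [h]
  have h2 : ∑ a ∈ (imgNbrs d b u).filter (fun a => ¬ ξ a = 1), spinAt a ξ =
      -(#((imgNbrs d b u).filter fun a => ξ a = -1) : ℝ) := by
    rw [hset, card_eq_sum_ones, Nat.cast_sum, Nat.cast_one, ← sum_neg_distrib]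
    refine sum_congr rfl fun a ha => ?_
    simp [spinAt, (mem_filter.1 ha).2]
  rw [h1, h2]
  ring

end Objects

/-! ### The axial segment through an incidence -/

section Segment

variable {b : ℕ}

/-- The axis `j` and the sign `s = ±1` of the step from the image site `a` to its neighbour `u`
(`u = a + s eⱼ`), for `d ≥ 1`. [cite: VanenterFernandezSokal1993, App. B.5.3] -/
def axisSign (hd : 2 ≤ d) (a u : Site d) : Fin d × ℤ :=
  open Classical in
  if h : ∃ js : Fin d × ℤ, (js.2 = 1 ∨ js.2 = -1) ∧ u = a + js.2 • (Pi.single js.1 (1 : ℤ) : Site d)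
  then Classical.choose h else (⟨0, by omega⟩, 1)

/-- The defining property of `axisSign` on an edge. [cite: VanenterFernandezSokal1993, App. B.5.3] -/
theorem axisSign_spec (hd : 2 ≤ d) {a u : Site d} (h : (zdGraph d).Adj a u) :
    ((axisSign hd a u).2 = 1 ∨ (axisSign hd a u).2 = -1) ∧
      u = a + (axisSign hd a u).2 • (Pi.single (axisSign hd a u).1 (1 : ℤ) : Site d) := by
  have hex := exists_axisSign_of_adj h
  unfold axisSign
  rw [dif_pos hex]
  exact Classical.choose_spec hex

/-- **The sites `a + s t eⱼ` of the axial line through the incidence `(u, a)`** (`t = 0`: the image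
site, `t = 1`: `u`, `t = b`: the next image site, `1 ≤ t ≤ b-1`: the internal segment between
them). [cite: VanenterFernandezSokal1993, App. B.5.3 (p. 239)] -/
def segPt (hd : 2 ≤ d) (a u : Site d) (t : ℤ) : Site d :=
  a + ((axisSign hd a u).2 * t) • (Pi.single (axisSign hd a u).1 (1 : ℤ) : Site d)

/-- `segPt 1 = u`. [cite: VanenterFernandezSokal1993, App. B.5.3] -/
theorem segPt_one (hd : 2 ≤ d) {a u : Site d} (h : (zdGraph d).Adj a u) : segPt hd a u 1 = u := by
  rw [segPt, mul_one, ← (axisSign_spec hd h).2]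

/-- Consecutive segment sites differ by the unit step. [cite: VanenterFernandezSokal1993, App. B.5.3] -/
theorem segPt_add_one (hd : 2 ≤ d) (a u : Site d) (t : ℤ) :
    segPt hd a u (t + 1) = segPt hd a u t + (axisSign hd a u).2 • (Pi.single (axisSign hd a u).1 (1 : ℤ) : Site d) := by
  rw [segPt, segPt, mul_add, mul_one, add_smul, add_assoc]

/-- Consecutive segment sites are adjacent. [cite: VanenterFernandezSokal1993, App. B.5.3] -/
theorem segPt_adj_succ (hd : 2 ≤ d) {a u : Site d} (h : (zdGraph d).Adj a u) (t : ℤ) :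
    (zdGraph d).Adj (segPt hd a u t) (segPt hd a u (t + 1)) := by
  rw [segPt_add_one]
  exact zdGraph_adj_add_zsmul_single _ _ (axisSign_spec hd h).1

/-- An offset `s t` with `s = ±1` and `0 < |t| < b` is not divisible by `b`. [folklore] -/
theorem not_dvd_sign_mul' {s t : ℤ} (hs : s = 1 ∨ s = -1) (ht0 : t ≠ 0) (htb : |t| < b) :
    ¬ (b : ℤ) ∣ s * t := by
  refine not_dvd_of_abs_lt (mul_ne_zero ?_ ht0) ?_
  · rcases hs with h1 | h1 <;> simp [h1]
  · rcases hs with h1 | h1 <;> simpa [h1, abs_mul] using htb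

/-- The offset `s t` of a segment site with `0 < |t| < b` is not divisible by `b`. [folklore] -/
theorem not_dvd_sign_mul (hd : 2 ≤ d) {a u : Site d} (h : (zdGraph d).Adj a u) {t : ℤ} (ht0 : t ≠ 0)
    (htb : |t| < b) : ¬ (b : ℤ) ∣ (axisSign hd a u).2 * t :=
  not_dvd_sign_mul' (axisSign_spec hd h).1 ht0 htb

/-- **Internal segment sites have exactly one coordinate indivisible by `b`** (`0 < |t| < b`).
[cite: VanenterFernandezSokal1993, App. B.5.3] -/
theorem nmCoords_segPt (hd : 2 ≤ d) {a u : Site d} (ha : IsSpImageSite d b a) (h : (zdGraph d).Adj a u)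
    {t : ℤ} (ht0 : t ≠ 0) (htb : |t| < b) : nmCoords b (segPt hd a u t) = {(axisSign hd a u).1} :=
  nmCoords_add_zsmul_single ha _ (not_dvd_sign_mul hd h ht0 htb)

/-- Internal segment sites are internal. [cite: VanenterFernandezSokal1993, App. B.5.3] -/
theorem not_isSpImageSite_segPt (hd : 2 ≤ d) {a u : Site d} (ha : IsSpImageSite d b a)
    (h : (zdGraph d).Adj a u) {t : ℤ} (ht0 : t ≠ 0) (htb : |t| < b) :
    ¬ IsSpImageSite d b (segPt hd a u t) :=
  not_isSpImageSite_of_mem_nmCoords (i := (axisSign hd a u).1)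
    (by rw [nmCoords_segPt hd ha h ht0 htb]; exact mem_singleton_self _)

/-- **The lateral neighbour `segPt t + eᵢ` (`i ≠ j`) has two coordinates indivisible by `b`.**
[cite: VanenterFernandezSokal1993, App. B.5.3] -/
theorem nmCoords_segPt_add_single (hd : 2 ≤ d) (hb : 2 ≤ b) {a u : Site d} (ha : IsSpImageSite d b a)
    (h : (zdGraph d).Adj a u) {t : ℤ} (ht0 : t ≠ 0) (htb : |t| < b) {i : Fin d}
    (hi : i ≠ (axisSign hd a u).1) :
    nmCoords b (segPt hd a u t + (Pi.single i (1 : ℤ) : Site d)) = {(axisSign hd a u).1, i} :=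
  nmCoords_add_zsmul_single_add_single hb ha hi (not_dvd_sign_mul hd h ht0 htb)

/-- `#nmCoords (segPt t) = 1` on the internal segment. [cite: VanenterFernandezSokal1993, App. B.5.3] -/
theorem card_nmCoords_segPt (hd : 2 ≤ d) {a u : Site d} (ha : IsSpImageSite d b a)
    (h : (zdGraph d).Adj a u) {t : ℤ} (ht0 : t ≠ 0) (htb : |t| < b) :
    #(nmCoords b (segPt hd a u t)) = 1 := by
  rw [nmCoords_segPt hd ha h ht0 htb, card_singleton]

/-- `#nmCoords (segPt t + eᵢ) = 2` for a lateral direction `i`. [cite: VanenterFernandezSokal1993, App. B.5.3] -/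
theorem card_nmCoords_segPt_add_single (hd : 2 ≤ d) (hb : 2 ≤ b) {a u : Site d}
    (ha : IsSpImageSite d b a) (h : (zdGraph d).Adj a u) {t : ℤ} (ht0 : t ≠ 0) (htb : |t| < b)
    {i : Fin d} (hi : i ≠ (axisSign hd a u).1) :
    #(nmCoords b (segPt hd a u t + (Pi.single i (1 : ℤ) : Site d))) = 2 := by
  rw [nmCoords_segPt_add_single hd hb ha h ht0 htb hi, card_pair hi.symm]

/-- `segPt b = a + s b eⱼ` is the next image site along the axis, `+` when `ξ_a = -` by
isolation. [cite: VanenterFernandezSokal1993, App. B.5.3 (p. 239)] -/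
theorem apply_segPt_self_eq_one (hd : 2 ≤ d) {ξ : SpinConfig (Site d)} (hξ : MinusIsolated d b ξ)
    {a u : Site d} (ha : IsSpImageSite d b a) (h : (zdGraph d).Adj a u) (hneg : ξ a = -1) :
    ξ (segPt hd a u b) = 1 :=
  hξ a ha hneg _ _ (axisSign_spec hd h).1

/-- `segPt b` is an image site. [cite: VanenterFernandezSokal1993, App. B.5.3] -/
theorem isSpImageSite_segPt_self (hd : 2 ≤ d) {a u : Site d} (ha : IsSpImageSite d b a) :
    IsSpImageSite d b (segPt hd a u b) :=
  isSpImageSite_add_zsmul_single ha _ (dvd_mul_left _ _)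

/-- `segPt b` is an image neighbour of `segPt (b-1)`. [cite: VanenterFernandezSokal1993, App. B.5.3] -/
theorem segPt_self_mem_imgNbrs (hd : 2 ≤ d) {a u : Site d} (ha : IsSpImageSite d b a)
    (h : (zdGraph d).Adj a u) : segPt hd a u b ∈ imgNbrs d b (segPt hd a u ((b : ℤ) - 1)) := by
  rw [mem_imgNbrs]
  refine ⟨?_, isSpImageSite_segPt_self hd ha⟩
  have := segPt_adj_succ hd h ((b : ℤ) - 1)
  rwa [sub_add_cancel] at this

/-- **Two incidences with `-` image spins whose segments meet coincide** (the decoding step of the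
injectivity arguments): if `⟨u, a⟩`, `⟨u', a'⟩ ∈ minusInc` and `segPt a u t = segPt a' u' t'` with
`0 < t, t' < b`, then the pairs are equal and `t = t'`. Indeed the common site forces the same axis,
`a' = a + (st - s't') eⱼ` with `b ∣ st - s't'`, `|st - s't'| < 2b`; the cases `± b` would make `a'`
the `+` image site next to `a` (isolation), so `st = s't'`, whence `s = s'`, `t = t'`, `a = a'`,
`u = u'`. [cite: VanenterFernandezSokal1993, App. B.5.3 (p. 239)] -/
theorem eq_of_segPt_eq (hd : 2 ≤ d) {ξ : SpinConfig (Site d)} (hξ : MinusIsolated d b ξ)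
    {M : Finset (Site d)} {x x' : Σ _ : Site d, Site d} (hx : x ∈ minusInc d b ξ M)
    (hx' : x' ∈ minusInc d b ξ M) {t t' : ℤ} (ht : 0 < t) (htb : t < b) (ht' : 0 < t') (htb' : t' < b)
    (heq : segPt hd x.2 x.1 t = segPt hd x'.2 x'.1 t') : x = x' ∧ t = t' := by
  obtain ⟨-, hxa, hxneg⟩ := mem_minusInc.1 hx
  obtain ⟨-, hxa', hxneg'⟩ := mem_minusInc.1 hx'
  obtain ⟨hadj, ha⟩ := mem_imgNbrs.1 hxa
  obtain ⟨hadj', ha'⟩ := mem_imgNbrs.1 hxa'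
  obtain ⟨hss, hu⟩ := axisSign_spec hd hadj.symm
  obtain ⟨hss', hu'⟩ := axisSign_spec hd hadj'.symm
  unfold segPt at heq
  generalize hjs : axisSign hd x.2 x.1 = js at hss hu heq
  generalize hjs' : axisSign hd x'.2 x'.1 = js' at hss' hu' heq
  obtain ⟨j, s⟩ := js
  obtain ⟨j', s'⟩ := js'
  simp only at hss hu heq hss' hu'
  have hc : ¬ (b : ℤ) ∣ s * t := not_dvd_sign_mul' hss ht.ne' (by rw [abs_of_pos ht]; exact htb)
  have hc' : ¬ (b : ℤ) ∣ s' * t' := not_dvd_sign_mul' hss' ht'.ne' (by rw [abs_of_pos ht']; exact htb')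
  obtain ⟨hjj, ha'eq⟩ := eq_of_add_zsmul_single_eq ha ha' hc hc' heq
  have hdvd := dvd_sub_of_add_zsmul_single_eq ha ha' hc hc' heq
  -- `|st - s't'| < 2b`, so the difference is `0` or `±b`
  have habs : |s * t - s' * t'| < 2 * b := by
    have h1 : |s * t| < b := by
      rcases hss with h | h <;> simp [h, abs_of_pos ht, htb]
    have h2 : |s' * t'| < b := by
      rcases hss' with h | h <;> simp [h, abs_of_pos ht', htb']
    calc |s * t - s' * t'| ≤ |s * t| + |s' * t'| := abs_sub _ _
      _ < b + b := add_lt_add h1 h2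
      _ = 2 * b := by ring
  obtain ⟨k, hk⟩ := hdvd
  have hb0 : (0 : ℤ) < b := by omega
  have hkabs : |k| < 2 := by
    have : |(b : ℤ) * k| < 2 * b := hk ▸ habs
    rw [abs_mul, abs_of_pos hb0] at this
    nlinarith [abs_nonneg k]
  have hk01 : k = 0 ∨ k = 1 ∨ k = -1 := by
    rcases lt_trichotomy k 0 with h | h | h
    · right; right; rw [abs_of_neg h] at hkabs; omega
    · exact Or.inl h
    · right; left; rw [abs_of_pos h] at hkabs; omega
  -- the cases `k = ±1` contradict isolation
  have hexcl : ∀ r : ℤ, (r = 1 ∨ r = -1) → s * t - s' * t' = b * r → False := by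
    intro r hr hrr
    have himg : ξ (x.2 + (r * b) • (Pi.single j (1 : ℤ) : Site d)) = 1 := hξ x.2 ha hxneg j r hr
    have : x'.2 = x.2 + (r * b) • (Pi.single j (1 : ℤ) : Site d) := by rw [ha'eq, hrr, mul_comm]
    rw [← this, hxneg'] at himg
    exact absurd himg (by decide)
  rcases hk01 with rfl | rfl | rfl
  · -- `st = s't'`
    rw [mul_zero] at hk
    have hst : s * t = s' * t' := sub_eq_zero.1 hk
    have haa : x'.2 = x.2 := by rw [ha'eq, hk, zero_smul, add_zero]
    have hsst : s = s' ∧ t = t' := by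
      rcases hss with h | h <;> rcases hss' with h' | h' <;> rw [h, h'] at hst <;>
        first | exact ⟨h.trans h'.symm, by linarith⟩ | (exfalso; nlinarith)
    obtain ⟨hss_eq, rfl⟩ := hsst
    refine ⟨?_, rfl⟩
    -- `u = a + s eⱼ = u'`
    have huu : x.1 = x'.1 := by rw [hu, hu', haa, hss_eq, hjj]
    rcases x with ⟨u, a⟩
    rcases x' with ⟨u', a'⟩
    simp only at huu haa
    subst huu; subst haa
    rfl
  · exact (hexcl 1 (Or.inl rfl) (by rw [hk])).elim
  · exact (hexcl (-1) (Or.inr rfl) (by rw [hk])).elim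

end Segment

/-! ### Cancellation: paired `-` incidences inject into `+` incidences -/

section Cancel

variable {b : ℕ}

/-- **The cancelling axialPartner** of an incidence `⟨u, a⟩`, `u = a + s eⱼ`: the pair
`⟨a + s(b-1)eⱼ, a + s b eⱼ⟩` formed by the next image site along the axis and its neighbour on the
segment ("look for the next image spin … of opposite sign and located to the right and along the
same line", p. 239). [cite: VanenterFernandezSokal1993, App. B.5.3 (p. 239)] -/
def axialPartner (hd : 2 ≤ d) (b : ℕ) (x : Σ _ : Site d, Site d) : Σ _ : Site d, Site d :=
  ⟨segPt hd x.2 x.1 ((b : ℤ) - 1), segPt hd x.2 x.1 b⟩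

variable (d b) in
/-- The `-` incidences whose axialPartner's internal site lies in `M` (these are cancelled).
[cite: VanenterFernandezSokal1993, App. B.5.3 (p. 239)] -/
def pairedInc (hd : 2 ≤ d) (ξ : SpinConfig (Site d)) (M : Finset (Site d)) : Finset (Σ _ : Site d, Site d) :=
  (minusInc d b ξ M).filter fun x => (axialPartner hd b x).1 ∈ M

variable (d b) in
/-- The `-` incidences whose axialPartner's internal site lies outside `M` (the "remaining" ones of
p. 239, to be paid by the contour). [cite: VanenterFernandezSokal1993, App. B.5.3 (p. 239)] -/
def unpairedInc (hd : 2 ≤ d) (ξ : SpinConfig (Site d)) (M : Finset (Site d)) :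
    Finset (Σ _ : Site d, Site d) :=
  (minusInc d b ξ M).filter fun x => (axialPartner hd b x).1 ∉ M

/-- `#minusInc = #paired + #unpaired`. [cite: VanenterFernandezSokal1993, App. B.5.3] -/
theorem card_pairedInc_add_card_unpairedInc (hd : 2 ≤ d) (ξ : SpinConfig (Site d)) (M : Finset (Site d)) :
    #(pairedInc d b hd ξ M) + #(unpairedInc d b hd ξ M) = #(minusInc d b ξ M) :=
  card_filter_add_card_filter_not _

/-- **A paired `-` incidence cancels against a `+` incidence**: its axialPartner lies in `plusInc`
(the next image site along the axis is `+` by isolation, and is an image neighbour of its segment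
neighbour, which lies in `M`). [cite: VanenterFernandezSokal1993, App. B.5.3 (p. 239)] -/
theorem axialPartner_mem_plusInc (hd : 2 ≤ d) {ξ : SpinConfig (Site d)} (hξ : MinusIsolated d b ξ)
    {M : Finset (Site d)} {x : Σ _ : Site d, Site d} (hx : x ∈ pairedInc d b hd ξ M) :
    axialPartner hd b x ∈ plusInc d b ξ M := by
  obtain ⟨hx, hpM⟩ := mem_filter.1 hx
  obtain ⟨-, hxa, hxneg⟩ := mem_minusInc.1 hx
  obtain ⟨hadj, ha⟩ := mem_imgNbrs.1 hxa
  exact mem_plusInc.2 ⟨hpM, segPt_self_mem_imgNbrs hd ha hadj.symm,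
    apply_segPt_self_eq_one hd hξ ha hadj.symm hxneg⟩

/-- The cancellation is injective (`b ≥ 2`): the axialPartner's internal site is a segment site at
offset `b - 1`, which determines the incidence (`eq_of_segPt_eq`).
[cite: VanenterFernandezSokal1993, App. B.5.3 (p. 239)] -/
theorem axialPartner_injOn (hd : 2 ≤ d) (hb : 2 ≤ b) {ξ : SpinConfig (Site d)} (hξ : MinusIsolated d b ξ)
    (M : Finset (Site d)) : Set.InjOn (axialPartner hd b) (pairedInc d b hd ξ M : Set (Σ _ : Site d, Site d)) := by
  intro x hx x' hx' heq
  have hx1 : x ∈ minusInc d b ξ M := (mem_filter.1 (mem_coe.1 hx)).1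
  have hx1' : x' ∈ minusInc d b ξ M := (mem_filter.1 (mem_coe.1 hx')).1
  have h1 : segPt hd x.2 x.1 ((b : ℤ) - 1) = segPt hd x'.2 x'.1 ((b : ℤ) - 1) := congrArg Sigma.fst heq
  exact (eq_of_segPt_eq hd hξ hx1 hx1' (by omega) (by omega) (by omega) (by omega) h1).1

/-- **`#paired ≤ #plusInc`** ("we cancel both contributions").
[cite: VanenterFernandezSokal1993, App. B.5.3 (p. 239)] -/
theorem card_pairedInc_le (hd : 2 ≤ d) (hb : 2 ≤ b) {ξ : SpinConfig (Site d)} (hξ : MinusIsolated d b ξ)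
    (M : Finset (Site d)) : #(pairedInc d b hd ξ M) ≤ #(plusInc d b ξ M) :=
  card_le_card_of_injOn (axialPartner hd b) (fun _ hx => axialPartner_mem_plusInc hd hξ hx) (axialPartner_injOn hd hb hξ M)

end Cancel

/-! ### The remaining `-` incidences: the exit of the segment from `M` and two boundary pairs -/

section Exit

variable {b : ℕ}

/-- **The exit index**: the least `t ≥ 1` with `a + s t eⱼ ∉ M` (it exists for unpaired
incidences, and then `2 ≤ t₀ ≤ b - 1`). [cite: VanenterFernandezSokal1993, App. B.5.3 (p. 239)] -/
def exitIdx (hd : 2 ≤ d) (M : Finset (Site d)) (x : Σ _ : Site d, Site d) : ℕ :=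
  open Classical in
  if h : ∃ t : ℕ, 1 ≤ t ∧ segPt hd x.2 x.1 t ∉ M then Nat.find h else 0

/-- A lateral direction: an axis different from `j` (`d ≥ 2`). [cite: VanenterFernandezSokal1993, App. B.5.3] -/
def latAxis (hd : 2 ≤ d) (j : Fin d) : Fin d :=
  if j = ⟨0, by omega⟩ then ⟨1, by omega⟩ else ⟨0, by omega⟩

/-- The lateral direction differs from the axis. [folklore] -/
theorem latAxis_ne (hd : 2 ≤ d) (j : Fin d) : latAxis hd j ≠ j := by
  unfold latAxis
  split_ifs with h
  · rw [h]; exact fun h' => absurd (congrArg Fin.val h') (by simp)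
  · exact fun h' => h h'.symm

/-- The last segment site inside `M`: `p = a + s(t₀-1)eⱼ`. [cite: VanenterFernandezSokal1993, App. B.5.3 (p. 239)] -/
def exitP (hd : 2 ≤ d) (M : Finset (Site d)) (x : Σ _ : Site d, Site d) : Site d :=
  segPt hd x.2 x.1 ((exitIdx hd M x : ℤ) - 1)

/-- The exit site: `q = a + s t₀ eⱼ ∉ M`. [cite: VanenterFernandezSokal1993, App. B.5.3 (p. 239)] -/
def exitQ (hd : 2 ≤ d) (M : Finset (Site d)) (x : Σ _ : Site d, Site d) : Site d :=
  segPt hd x.2 x.1 (exitIdx hd M x)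

/-- The lateral unit vector `eᵢ`, `i = latAxis j`. [cite: VanenterFernandezSokal1993, App. B.5.3] -/
def latVec (hd : 2 ≤ d) (x : Σ _ : Site d, Site d) : Site d :=
  Pi.single (latAxis hd (axisSign hd x.2 x.1).1) (1 : ℤ)

/-- **The first boundary pair** of an unpaired incidence: the axial exit `(p, q)`.
[cite: VanenterFernandezSokal1993, App. B.5.3 (p. 239)] -/
def bdryPair₁ (hd : 2 ≤ d) (M : Finset (Site d)) (x : Σ _ : Site d, Site d) : Site d × Site d :=
  (exitP hd M x, exitQ hd M x)

/-- **The second boundary pair** of an unpaired incidence, next to the exit in the lateral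
direction `eᵢ`: `(q + eᵢ, q)` if `q + eᵢ ∈ M`; else `(p, p + eᵢ)` if `p + eᵢ ∉ M`; else
`(p + eᵢ, q + eᵢ)`. [cite: VanenterFernandezSokal1993, App. B.5.3 (p. 239)] -/
def bdryPair₂ (hd : 2 ≤ d) (M : Finset (Site d)) (x : Σ _ : Site d, Site d) : Site d × Site d :=
  if exitQ hd M x + latVec hd x ∈ M then (exitQ hd M x + latVec hd x, exitQ hd M x)
  else if exitP hd M x + latVec hd x ∉ M then (exitP hd M x, exitP hd M x + latVec hd x)
  else (exitP hd M x + latVec hd x, exitQ hd M x + latVec hd x)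

/-- **The exit index of an unpaired incidence** (`b ≥ 2`): `2 ≤ t₀ ≤ b - 1`, the exit site
`q = segPt t₀` is outside `M`, and `segPt t ∈ M` for `1 ≤ t < t₀`.
[cite: VanenterFernandezSokal1993, App. B.5.3 (p. 239)] -/
theorem exitIdx_spec (hd : 2 ≤ d) (hb : 2 ≤ b) {ξ : SpinConfig (Site d)} {M : Finset (Site d)}
    {x : Σ _ : Site d, Site d} (hx : x ∈ unpairedInc d b hd ξ M) :
    2 ≤ exitIdx hd M x ∧ exitIdx hd M x + 1 ≤ b ∧ segPt hd x.2 x.1 (exitIdx hd M x) ∉ M ∧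
      ∀ t : ℕ, 1 ≤ t → t < exitIdx hd M x → segPt hd x.2 x.1 t ∈ M := by
  classical
  obtain ⟨hx, hpM⟩ := mem_filter.1 hx
  obtain ⟨huM, hxa, -⟩ := mem_minusInc.1 hx
  obtain ⟨hadj, -⟩ := mem_imgNbrs.1 hxa
  have hb1 : ((b - 1 : ℕ) : ℤ) = (b : ℤ) - 1 := by
    rw [Nat.cast_sub (by omega : 1 ≤ b), Nat.cast_one]
  have hex : ∃ t : ℕ, 1 ≤ t ∧ segPt hd x.2 x.1 t ∉ M :=
    ⟨b - 1, by omega, by rw [hb1]; exact hpM⟩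
  have hdef : exitIdx hd M x = Nat.find hex := by
    unfold exitIdx; rw [dif_pos hex]
  rw [hdef]
  obtain ⟨h1, hout⟩ := Nat.find_spec hex
  have hle : Nat.find hex ≤ b - 1 := Nat.find_min' hex ⟨by omega, by rw [hb1]; exact hpM⟩
  have hmin : ∀ t : ℕ, 1 ≤ t → t < Nat.find hex → segPt hd x.2 x.1 t ∈ M := by
    intro t ht htl
    have := Nat.find_min hex htl
    simp only [not_and, not_not] at this
    exact this ht
  have h2 : 2 ≤ Nat.find hex := by
    by_contra hlt
    have h1' : Nat.find hex = 1 := by omega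
    rw [h1', Nat.cast_one, segPt_one hd hadj.symm] at hout
    exact hout huM
  exact ⟨h2, by omega, hout, hmin⟩

variable {ξ : SpinConfig (Site d)} {M : Finset (Site d)} {x x' : Σ _ : Site d, Site d}

/-- `p ∈ M`. [cite: VanenterFernandezSokal1993, App. B.5.3 (p. 239)] -/
theorem exitP_mem (hd : 2 ≤ d) (hb : 2 ≤ b) (hx : x ∈ unpairedInc d b hd ξ M) : exitP hd M x ∈ M := by
  obtain ⟨h2, -, -, hmin⟩ := exitIdx_spec hd hb hx
  have := hmin (exitIdx hd M x - 1) (by omega) (by omega)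
  rwa [Nat.cast_sub (by omega : 1 ≤ exitIdx hd M x), Nat.cast_one] at this

/-- `q ∉ M`. [cite: VanenterFernandezSokal1993, App. B.5.3 (p. 239)] -/
theorem exitQ_not_mem (hd : 2 ≤ d) (hb : 2 ≤ b) (hx : x ∈ unpairedInc d b hd ξ M) : exitQ hd M x ∉ M :=
  (exitIdx_spec hd hb hx).2.2.1

/-- `q = p + s eⱼ`. [cite: VanenterFernandezSokal1993, App. B.5.3] -/
theorem exitQ_eq (hd : 2 ≤ d) (M : Finset (Site d)) (x : Σ _ : Site d, Site d) :
    exitQ hd M x = exitP hd M x + (axisSign hd x.2 x.1).2 • (Pi.single (axisSign hd x.2 x.1).1 (1 : ℤ) : Site d) := by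
  rw [exitP, ← segPt_add_one, sub_add_cancel, exitQ]

/-- The data of an unpaired incidence used below: `a` is an image site adjacent to `u`.
[cite: VanenterFernandezSokal1993, App. B.5.3] -/
theorem adj_of_mem_unpairedInc (hd : 2 ≤ d) (hx : x ∈ unpairedInc d b hd ξ M) :
    (zdGraph d).Adj x.2 x.1 ∧ IsSpImageSite d b x.2 := by
  obtain ⟨-, hxa, -⟩ := mem_minusInc.1 (mem_filter.1 hx).1
  obtain ⟨hadj, ha⟩ := mem_imgNbrs.1 hxa
  exact ⟨hadj.symm, ha⟩

/-- `#nmCoords p = 1`. [cite: VanenterFernandezSokal1993, App. B.5.3] -/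
theorem card_nmCoords_exitP (hd : 2 ≤ d) (hb : 2 ≤ b) (hx : x ∈ unpairedInc d b hd ξ M) :
    #(nmCoords b (exitP hd M x)) = 1 := by
  obtain ⟨h2, hle, -, -⟩ := exitIdx_spec hd hb hx
  obtain ⟨hadj, ha⟩ := adj_of_mem_unpairedInc hd hx
  refine card_nmCoords_segPt hd ha hadj (by omega) ?_
  rw [abs_of_pos (by omega)]; omega

/-- `#nmCoords q = 1`. [cite: VanenterFernandezSokal1993, App. B.5.3] -/
theorem card_nmCoords_exitQ (hd : 2 ≤ d) (hb : 2 ≤ b) (hx : x ∈ unpairedInc d b hd ξ M) :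
    #(nmCoords b (exitQ hd M x)) = 1 := by
  obtain ⟨h2, hle, -, -⟩ := exitIdx_spec hd hb hx
  obtain ⟨hadj, ha⟩ := adj_of_mem_unpairedInc hd hx
  refine card_nmCoords_segPt hd ha hadj (by omega) ?_
  rw [abs_of_pos (by omega)]; omega

/-- `#nmCoords (p + eᵢ) = 2`. [cite: VanenterFernandezSokal1993, App. B.5.3] -/
theorem card_nmCoords_exitP_add (hd : 2 ≤ d) (hb : 2 ≤ b) (hx : x ∈ unpairedInc d b hd ξ M) :
    #(nmCoords b (exitP hd M x + latVec hd x)) = 2 := by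
  obtain ⟨h2, hle, -, -⟩ := exitIdx_spec hd hb hx
  obtain ⟨hadj, ha⟩ := adj_of_mem_unpairedInc hd hx
  refine card_nmCoords_segPt_add_single hd hb ha hadj (by omega) ?_ (latAxis_ne hd _)
  rw [abs_of_pos (by omega)]; omega

/-- `#nmCoords (q + eᵢ) = 2`. [cite: VanenterFernandezSokal1993, App. B.5.3] -/
theorem card_nmCoords_exitQ_add (hd : 2 ≤ d) (hb : 2 ≤ b) (hx : x ∈ unpairedInc d b hd ξ M) :
    #(nmCoords b (exitQ hd M x + latVec hd x)) = 2 := by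
  obtain ⟨h2, hle, -, -⟩ := exitIdx_spec hd hb hx
  obtain ⟨hadj, ha⟩ := adj_of_mem_unpairedInc hd hx
  refine card_nmCoords_segPt_add_single hd hb ha hadj (by omega) ?_ (latAxis_ne hd _)
  rw [abs_of_pos (by omega)]; omega

/-- A site with two coordinates indivisible by `b` is internal. [folklore] -/
theorem not_isSpImageSite_of_card_nmCoords {y : Site d} (h : #(nmCoords b y) = 2) : ¬ IsSpImageSite d b y := by
  intro hy
  rw [nmCoords_eq_empty_of_isSpImageSite hy, card_empty] at h
  exact absurd h (by norm_num)

/-- A site with one coordinate indivisible by `b` is internal. [folklore] -/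
theorem not_isSpImageSite_of_card_nmCoords_one {y : Site d} (h : #(nmCoords b y) = 1) :
    ¬ IsSpImageSite d b y := by
  intro hy
  rw [nmCoords_eq_empty_of_isSpImageSite hy, card_empty] at h
  exact absurd h (by norm_num)

/-- A unit coordinate step is an edge. [cite: FriedliVelenik2017, §3.1] -/
theorem zdGraph_adj_add_single_one (y : Site d) (i : Fin d) :
    (zdGraph d).Adj y (y + (Pi.single i (1 : ℤ) : Site d)) := by
  simpa using zdGraph_adj_add_zsmul_single y i (s := 1) (Or.inl rfl)

/-- **The axial exit is a boundary pair of `M`.** [cite: VanenterFernandezSokal1993, App. B.5.3 (p. 239)] -/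
theorem bdryPair₁_mem (hd : 2 ≤ d) (hb : 2 ≤ b) (hx : x ∈ unpairedInc d b hd ξ M) :
    bdryPair₁ hd M x ∈ ffBdryPairs d b M := by
  obtain ⟨hadj, ha⟩ := adj_of_mem_unpairedInc hd hx
  refine mem_ffBdryPairs.2 ⟨exitP_mem hd hb hx, exitQ_not_mem hd hb hx,
    not_isSpImageSite_of_card_nmCoords_one (card_nmCoords_exitQ hd hb hx), ?_⟩
  show (zdGraph d).Adj (exitP hd M x) (exitQ hd M x)
  rw [exitQ_eq]
  exact zdGraph_adj_add_zsmul_single _ _ (axisSign_spec hd hadj).1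

/-- **The lateral pair is a boundary pair of `M`** (in each of the three cases).
[cite: VanenterFernandezSokal1993, App. B.5.3 (p. 239)] -/
theorem bdryPair₂_mem (hd : 2 ≤ d) (hb : 2 ≤ b) (hx : x ∈ unpairedInc d b hd ξ M) :
    bdryPair₂ hd M x ∈ ffBdryPairs d b M := by
  obtain ⟨hadj, ha⟩ := adj_of_mem_unpairedInc hd hx
  unfold bdryPair₂
  split_ifs with h1 h2
  · -- case `(q + eᵢ, q)`
    exact mem_ffBdryPairs.2 ⟨h1, exitQ_not_mem hd hb hx,
      not_isSpImageSite_of_card_nmCoords_one (card_nmCoords_exitQ hd hb hx),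
      (zdGraph_adj_add_single_one _ _).symm⟩
  · -- case `(p + eᵢ, q + eᵢ)`
    refine mem_ffBdryPairs.2 ⟨h2, h1,
      not_isSpImageSite_of_card_nmCoords (card_nmCoords_exitQ_add hd hb hx), ?_⟩
    show (zdGraph d).Adj (exitP hd M x + latVec hd x) (exitQ hd M x + latVec hd x)
    rw [exitQ_eq, add_right_comm]
    exact zdGraph_adj_add_zsmul_single _ _ (axisSign_spec hd hadj).1
  · -- case `(p, p + eᵢ)`
    exact mem_ffBdryPairs.2 ⟨exitP_mem hd hb hx, h2,
      not_isSpImageSite_of_card_nmCoords (card_nmCoords_exitP_add hd hb hx), zdGraph_adj_add_single_one _ _⟩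

/-- Decoding from `q`: unpaired incidences with the same exit site coincide.
[cite: VanenterFernandezSokal1993, App. B.5.3 (p. 239)] -/
theorem eq_of_exitQ_eq (hd : 2 ≤ d) (hb : 2 ≤ b) (hξ : MinusIsolated d b ξ)
    (hx : x ∈ unpairedInc d b hd ξ M) (hx' : x' ∈ unpairedInc d b hd ξ M)
    (h : exitQ hd M x = exitQ hd M x') : x = x' := by
  obtain ⟨h2, hle, -, -⟩ := exitIdx_spec hd hb hx
  obtain ⟨h2', hle', -, -⟩ := exitIdx_spec hd hb hx'
  exact (eq_of_segPt_eq hd hξ (mem_filter.1 hx).1 (mem_filter.1 hx').1 (by omega) (by omega)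
    (by omega) (by omega) h).1

/-- Decoding from `p`: unpaired incidences with the same last inside site coincide.
[cite: VanenterFernandezSokal1993, App. B.5.3 (p. 239)] -/
theorem eq_of_exitP_eq (hd : 2 ≤ d) (hb : 2 ≤ b) (hξ : MinusIsolated d b ξ)
    (hx : x ∈ unpairedInc d b hd ξ M) (hx' : x' ∈ unpairedInc d b hd ξ M)
    (h : exitP hd M x = exitP hd M x') : x = x' := by
  obtain ⟨h2, hle, -, -⟩ := exitIdx_spec hd hb hx
  obtain ⟨h2', hle', -, -⟩ := exitIdx_spec hd hb hx'
  exact (eq_of_segPt_eq hd hξ (mem_filter.1 hx).1 (mem_filter.1 hx').1 (by omega) (by omega)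
    (by omega) (by omega) h).1

/-- Unit steps determine their axis and sign. [folklore] -/
theorem eq_of_zsmul_single_eq {j j' : Fin d} {s s' : ℤ} (hs : s = 1 ∨ s = -1)
    (h : s • (Pi.single j (1 : ℤ) : Site d) = s' • (Pi.single j' (1 : ℤ) : Site d)) : j = j' ∧ s = s' := by
  have hj := congrFun h j
  simp only [Pi.smul_apply, Pi.single_apply, smul_eq_mul, if_true, mul_one, mul_ite, mul_zero] at hj
  by_cases hjj : j = j'
  · subst hjj
    rw [if_pos rfl] at hj
    exact ⟨rfl, hj⟩
  · rw [if_neg hjj] at hj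
    rcases hs with rfl | rfl <;> norm_num at hj

/-- Decoding in the third case: the pairs `(p + eᵢ, q + eᵢ)` determine the incidence.
[cite: VanenterFernandezSokal1993, App. B.5.3 (p. 239)] -/
theorem eq_of_add_latVec_eq (hd : 2 ≤ d) (hb : 2 ≤ b) (hξ : MinusIsolated d b ξ)
    (hx : x ∈ unpairedInc d b hd ξ M) (hx' : x' ∈ unpairedInc d b hd ξ M)
    (hP : exitP hd M x + latVec hd x = exitP hd M x' + latVec hd x')
    (hQ : exitQ hd M x + latVec hd x = exitQ hd M x' + latVec hd x') : x = x' := by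
  obtain ⟨hadj, -⟩ := adj_of_mem_unpairedInc hd hx
  -- the unit step `q - p` is common, hence the axis, hence the lateral vector
  have hstep : (axisSign hd x.2 x.1).2 • (Pi.single (axisSign hd x.2 x.1).1 (1 : ℤ) : Site d) =
      (axisSign hd x'.2 x'.1).2 • (Pi.single (axisSign hd x'.2 x'.1).1 (1 : ℤ) : Site d) := by
    have h1 := exitQ_eq hd M x
    have h2 := exitQ_eq hd M x'
    have : exitQ hd M x + latVec hd x - (exitP hd M x + latVec hd x) =
        exitQ hd M x' + latVec hd x' - (exitP hd M x' + latVec hd x') := by rw [hP, hQ]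
    rwa [h1, h2, add_sub_add_right_eq_sub, add_sub_add_right_eq_sub, add_sub_cancel_left,
      add_sub_cancel_left] at this
  obtain ⟨hjj, -⟩ := eq_of_zsmul_single_eq (axisSign_spec hd hadj).1 hstep
  have hlat : latVec hd x = latVec hd x' := by rw [latVec, latVec, hjj]
  rw [hlat] at hP
  exact eq_of_exitP_eq hd hb hξ hx hx' (add_right_cancel hP)

/-- **The axial exits of distinct unpaired incidences are distinct.**
[cite: VanenterFernandezSokal1993, App. B.5.3 (p. 239)] -/
theorem bdryPair₁_injOn (hd : 2 ≤ d) (hb : 2 ≤ b) (hξ : MinusIsolated d b ξ) :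
    Set.InjOn (bdryPair₁ hd M) (unpairedInc d b hd ξ M : Set (Σ _ : Site d, Site d)) :=
  fun _ hx _ hx' h => eq_of_exitQ_eq hd hb hξ (mem_coe.1 hx) (mem_coe.1 hx') (congrArg Prod.snd h)

/-- Equal sites have equally many coordinates indivisible by `b`. [folklore] -/
theorem card_nmCoords_congr {y y' : Site d} (h : y = y') : #(nmCoords b y) = #(nmCoords b y') := by rw [h]

/-- **The lateral pairs of distinct unpaired incidences are distinct**: pairs of different cases
are told apart by the numbers `(2,1)`, `(1,2)`, `(2,2)` of coordinates indivisible by `b` of their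
endpoints, pairs of the same case by decoding. [cite: VanenterFernandezSokal1993, App. B.5.3 (p. 239)] -/
theorem bdryPair₂_injOn (hd : 2 ≤ d) (hb : 2 ≤ b) (hξ : MinusIsolated d b ξ) :
    Set.InjOn (bdryPair₂ hd M) (unpairedInc d b hd ξ M : Set (Σ _ : Site d, Site d)) := by
  intro x hx x' hx' h
  have hx := mem_coe.1 hx
  have hx' := mem_coe.1 hx'
  have cP := card_nmCoords_exitP hd hb hx
  have cQ := card_nmCoords_exitQ hd hb hx
  have cPe := card_nmCoords_exitP_add hd hb hx
  have cQe := card_nmCoords_exitQ_add hd hb hx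
  have cP' := card_nmCoords_exitP hd hb hx'
  have cQ' := card_nmCoords_exitQ hd hb hx'
  have cPe' := card_nmCoords_exitP_add hd hb hx'
  have cQe' := card_nmCoords_exitQ_add hd hb hx'
  unfold bdryPair₂ at h
  -- the cases, in the order produced by `split_ifs`: `(q+eᵢ, q)`, `(p+eᵢ, q+eᵢ)`, `(p, p+eᵢ)`
  split_ifs at h with h1 h2 h1' h2' h1'' h2'' <;>
    obtain ⟨hf, hs⟩ := Prod.mk.inj h
  · exact eq_of_exitQ_eq hd hb hξ hx hx' hs
  · have := card_nmCoords_congr (b := b) hs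
    rw [cQ, cQe'] at this; exact absurd this (by norm_num)
  · have := card_nmCoords_congr (b := b) hf
    rw [cQe, cP'] at this; exact absurd this (by norm_num)
  · have := card_nmCoords_congr (b := b) hs
    rw [cQe, cQ'] at this; exact absurd this (by norm_num)
  · exact eq_of_add_latVec_eq hd hb hξ hx hx' hf hs
  · have := card_nmCoords_congr (b := b) hf
    rw [cPe, cP'] at this; exact absurd this (by norm_num)
  · have := card_nmCoords_congr (b := b) hf
    rw [cP, cQe'] at this; exact absurd this (by norm_num)
  · have := card_nmCoords_congr (b := b) hf
    rw [cP, cPe'] at this; exact absurd this (by norm_num)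
  · exact eq_of_exitP_eq hd hb hξ hx hx' hf

/-- **The two boundary pairs of unpaired incidences never coincide** (the axial exit has
endpoints with one indivisible coordinate each). [cite: VanenterFernandezSokal1993, App. B.5.3 (p. 239)] -/
theorem bdryPair₁_ne_bdryPair₂ (hd : 2 ≤ d) (hb : 2 ≤ b) (hx : x ∈ unpairedInc d b hd ξ M)
    (hx' : x' ∈ unpairedInc d b hd ξ M) : bdryPair₁ hd M x ≠ bdryPair₂ hd M x' := by
  intro h
  have cP := card_nmCoords_exitP hd hb hx
  have cQ := card_nmCoords_exitQ hd hb hx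
  have cPe' := card_nmCoords_exitP_add hd hb hx'
  have cQe' := card_nmCoords_exitQ_add hd hb hx'
  unfold bdryPair₁ bdryPair₂ at h
  split_ifs at h with h1 h2 <;> obtain ⟨hf, hs⟩ := Prod.mk.inj h
  · have := card_nmCoords_congr (b := b) hf
    rw [cP, cQe'] at this; exact absurd this (by norm_num)
  · have := card_nmCoords_congr (b := b) hf
    rw [cP, cPe'] at this; exact absurd this (by norm_num)
  · have := card_nmCoords_congr (b := b) hs
    rw [cQ, cPe'] at this; exact absurd this (by norm_num)

/-- **`2 · #unpaired ≤ #ffBdryPairs`**: the two families of boundary pairs are injective images of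
the unpaired incidences, disjoint, inside `ffBdryPairs`.
[cite: VanenterFernandezSokal1993, App. B.5.3 eqs. (B.73)–(B.76)] -/
theorem two_mul_card_unpairedInc_le (hd : 2 ≤ d) (hb : 2 ≤ b) (hξ : MinusIsolated d b ξ)
    (M : Finset (Site d)) : 2 * #(unpairedInc d b hd ξ M) ≤ #(ffBdryPairs d b M) := by
  classical
  set U := unpairedInc d b hd ξ M with hU
  have h1 : #(U.image (bdryPair₁ hd M)) = #U := card_image_of_injOn (bdryPair₁_injOn hd hb hξ)
  have h2 : #(U.image (bdryPair₂ hd M)) = #U := card_image_of_injOn (bdryPair₂_injOn hd hb hξ)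
  have hsub : U.image (bdryPair₁ hd M) ∪ U.image (bdryPair₂ hd M) ⊆ ffBdryPairs d b M := by
    intro y hy
    rcases mem_union.1 hy with hy | hy
    · obtain ⟨x, hx, rfl⟩ := mem_image.1 hy
      exact bdryPair₁_mem hd hb hx
    · obtain ⟨x, hx, rfl⟩ := mem_image.1 hy
      exact bdryPair₂_mem hd hb hx
  have hdisj : Disjoint (U.image (bdryPair₁ hd M)) (U.image (bdryPair₂ hd M)) := by
    rw [disjoint_left]
    intro y hy hy'
    obtain ⟨x, hx, rfl⟩ := mem_image.1 hy
    obtain ⟨x', hx', heq⟩ := mem_image.1 hy'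
    exact bdryPair₁_ne_bdryPair₂ hd hb hx hx' heq.symm
  calc 2 * #U = #(U.image (bdryPair₁ hd M)) + #(U.image (bdryPair₂ hd M)) := by rw [h1, h2]; ring
    _ = #(U.image (bdryPair₁ hd M) ∪ U.image (bdryPair₂ hd M)) := (card_union_of_disjoint hdisj).symm
    _ ≤ #(ffBdryPairs d b M) := card_le_card hsub

end Exit

/-! ### Locality: the cancellation and the charged boundary pairs stay within distance `b` of the
`-` image spin (the form needed contour by contour) -/

section Locality

variable {b : ℕ}

/-- Segment sites stay within sup-distance `|t|` of the image site. [cite: VanenterFernandezSokal1993, App. B.5.3 (p. 239)] -/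
theorem supDist_segPt_le (hd : 2 ≤ d) {a u : Site d} (h : (zdGraph d).Adj a u) (t : ℤ) :
    supDist a (segPt hd a u t) ≤ t.natAbs := by
  rw [supDist_le_iff]
  intro i
  rw [segPt, add_zsmul_single_apply]
  split_ifs
  · rcases (axisSign_spec hd h).1 with h1 | h1 <;> simp [h1]
  · simp

/-- Their lateral neighbours stay within sup-distance `max |t| 1`. [cite: VanenterFernandezSokal1993, App. B.5.3 (p. 239)] -/
theorem supDist_segPt_add_single_le (hd : 2 ≤ d) {a u : Site d} (h : (zdGraph d).Adj a u) (t : ℤ)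
    {i : Fin d} (hi : i ≠ (axisSign hd a u).1) :
    supDist a (segPt hd a u t + (Pi.single i (1 : ℤ) : Site d)) ≤ max t.natAbs 1 := by
  rw [supDist_le_iff]
  intro k
  rw [Pi.add_apply, segPt, add_zsmul_single_apply, Pi.single_apply]
  by_cases hkj : k = (axisSign hd a u).1
  · rw [if_pos hkj, if_neg (hkj ▸ hi.symm)]
    rcases (axisSign_spec hd h).1 with h1 | h1 <;> simp [h1]
  · rw [if_neg hkj]
    by_cases hki : k = i
    · simp [hki]
    · simp [hki]

variable {ξ : SpinConfig (Site d)} {M : Finset (Site d)} {x : Σ _ : Site d, Site d}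

/-- **The cancelling `+` image spin lies at sup-distance `≤ b` from the `-` one** (it is
`a + s b eⱼ`), and its segment neighbour too. [cite: VanenterFernandezSokal1993, App. B.5.3 (p. 239)] -/
theorem supDist_axialPartner_le (hd : 2 ≤ d) (hb : 1 ≤ b) (hx : x ∈ minusInc d b ξ M) :
    supDist x.2 (axialPartner hd b x).1 ≤ b ∧ supDist x.2 (axialPartner hd b x).2 ≤ b := by
  obtain ⟨-, hxa, -⟩ := mem_minusInc.1 hx
  obtain ⟨hadj, -⟩ := mem_imgNbrs.1 hxa
  constructor
  · refine (supDist_segPt_le hd hadj.symm _).trans ?_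
    rw [show ((b : ℤ) - 1) = ((b - 1 : ℕ) : ℤ) by omega, Int.natAbs_natCast]
    omega
  · refine (supDist_segPt_le hd hadj.symm _).trans ?_
    simp

/-- **Both charged boundary pairs of an unpaired incidence lie within sup-distance `b` of its `-`
image spin** (`b ≥ 2`). [cite: VanenterFernandezSokal1993, App. B.5.3 (p. 239)] -/
theorem supDist_bdryPair_le (hd : 2 ≤ d) (hb : 2 ≤ b) (hx : x ∈ unpairedInc d b hd ξ M) :
    supDist x.2 (bdryPair₁ hd M x).1 ≤ b ∧ supDist x.2 (bdryPair₁ hd M x).2 ≤ b ∧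
      supDist x.2 (bdryPair₂ hd M x).1 ≤ b ∧ supDist x.2 (bdryPair₂ hd M x).2 ≤ b := by
  obtain ⟨h2, hle, -, -⟩ := exitIdx_spec hd hb hx
  obtain ⟨hadj, -⟩ := adj_of_mem_unpairedInc hd hx
  have hP : supDist x.2 (exitP hd M x) ≤ b := (supDist_segPt_le hd hadj _).trans (by omega)
  have hQ : supDist x.2 (exitQ hd M x) ≤ b := (supDist_segPt_le hd hadj _).trans (by omega)
  have hPe : supDist x.2 (exitP hd M x + latVec hd x) ≤ b :=
    (supDist_segPt_add_single_le hd hadj _ (latAxis_ne hd _)).trans (by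
      refine max_le ?_ (by omega); omega)
  have hQe : supDist x.2 (exitQ hd M x + latVec hd x) ≤ b :=
    (supDist_segPt_add_single_le hd hadj _ (latAxis_ne hd _)).trans (by
      refine max_le ?_ (by omega); omega)
  refine ⟨hP, hQ, ?_, ?_⟩ <;> unfold bdryPair₂ <;> split_ifs <;> assumption

variable (d b) in
/-- The `+` incidences whose image spin lies within sup-distance `b` of a set `S` of image sites.
[cite: VanenterFernandezSokal1993, App. B.5.3] -/
def plusIncNear (ξ : SpinConfig (Site d)) (M S : Finset (Site d)) : Finset (Σ _ : Site d, Site d) :=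
  (plusInc d b ξ M).filter fun y => ∃ a ∈ S, supDist a y.2 ≤ b

variable (d b) in
/-- The boundary pairs of `M` both of whose sites lie within sup-distance `b` of a set `S` of image
sites. [cite: VanenterFernandezSokal1993, App. B.5.3] -/
def ffBdryPairsNear (M S : Finset (Site d)) : Finset (Site d × Site d) :=
  (ffBdryPairs d b M).filter fun π => ∃ a ∈ S, supDist a π.1 ≤ b ∧ supDist a π.2 ≤ b

/-- **The Peierls condition, local form** (the estimate as it is used contour by contour in a
Pirogov–Sinai / chessboard argument: the `-` image spins of a region are paid by `+` image spins and
frustrated bonds within distance `b` of them): for every set `S` of image sites,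
`2 · #{⟨u,a⟩ ∈ minusInc : a ∈ S} ≤ 2 · #plusIncNear S + #ffBdryPairsNear S`.
[cite: VanenterFernandezSokal1993, App. B.5.3 eqs. (B.73)–(B.77)] -/
theorem two_mul_card_minusInc_filter_le (hd : 2 ≤ d) (hb : 2 ≤ b) (hξ : MinusIsolated d b ξ)
    (M S : Finset (Site d)) :
    2 * #((minusInc d b ξ M).filter fun x => x.2 ∈ S) ≤
      2 * #(plusIncNear d b ξ M S) + #(ffBdryPairsNear d b M S) := by
  classical
  set PS := (pairedInc d b hd ξ M).filter fun x => x.2 ∈ S with hPS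
  set US := (unpairedInc d b hd ξ M).filter fun x => x.2 ∈ S with hUS
  -- splitting the `S`-incidences into paired and unpaired ones
  have hPS' : PS = ((minusInc d b ξ M).filter fun x => x.2 ∈ S).filter
      fun x => (axialPartner hd b x).1 ∈ M := by
    rw [hPS, pairedInc, filter_comm]
  have hUS' : US = ((minusInc d b ξ M).filter fun x => x.2 ∈ S).filter
      fun x => ¬ (axialPartner hd b x).1 ∈ M := by
    rw [hUS, unpairedInc, filter_comm]
  have hsplit : #((minusInc d b ξ M).filter fun x => x.2 ∈ S) = #PS + #US := by
    rw [hPS', hUS']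
    exact (card_filter_add_card_filter_not _).symm
  -- paired ones inject into the nearby `+` incidences
  have hP : #PS ≤ #(plusIncNear d b ξ M S) := by
    refine card_le_card_of_injOn (axialPartner hd b) (fun x hx => ?_) fun x hx x' hx' h =>
      axialPartner_injOn hd hb hξ M (mem_coe.2 (mem_filter.1 (mem_coe.1 hx)).1)
        (mem_coe.2 (mem_filter.1 (mem_coe.1 hx')).1) h
    obtain ⟨hx, hxS⟩ := mem_filter.1 hx
    exact mem_filter.2 ⟨axialPartner_mem_plusInc hd hξ hx, x.2, hxS,
      (supDist_axialPartner_le hd (by omega) (mem_filter.1 hx).1).2⟩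
  -- unpaired ones receive two nearby boundary pairs each
  have hU : 2 * #US ≤ #(ffBdryPairsNear d b M S) := by
    have hUsub : US ⊆ unpairedInc d b hd ξ M := filter_subset _ _
    have h1 : #(US.image (bdryPair₁ hd M)) = #US :=
      card_image_of_injOn fun x hx x' hx' h => bdryPair₁_injOn hd hb hξ
        (mem_coe.2 (hUsub (mem_coe.1 hx))) (mem_coe.2 (hUsub (mem_coe.1 hx'))) h
    have h2 : #(US.image (bdryPair₂ hd M)) = #US :=
      card_image_of_injOn fun x hx x' hx' h => bdryPair₂_injOn hd hb hξ
        (mem_coe.2 (hUsub (mem_coe.1 hx))) (mem_coe.2 (hUsub (mem_coe.1 hx'))) h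
    have hsub : US.image (bdryPair₁ hd M) ∪ US.image (bdryPair₂ hd M) ⊆ ffBdryPairsNear d b M S := by
      intro y hy
      rcases mem_union.1 hy with hy | hy
      · obtain ⟨x, hx, rfl⟩ := mem_image.1 hy
        obtain ⟨hxU, hxS⟩ := mem_filter.1 hx
        obtain ⟨h₁, h₂, -, -⟩ := supDist_bdryPair_le hd hb hxU
        exact mem_filter.2 ⟨bdryPair₁_mem hd hb hxU, x.2, hxS, h₁, h₂⟩
      · obtain ⟨x, hx, rfl⟩ := mem_image.1 hy
        obtain ⟨hxU, hxS⟩ := mem_filter.1 hx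
        obtain ⟨-, -, h₃, h₄⟩ := supDist_bdryPair_le hd hb hxU
        exact mem_filter.2 ⟨bdryPair₂_mem hd hb hxU, x.2, hxS, h₃, h₄⟩
    have hdisj : Disjoint (US.image (bdryPair₁ hd M)) (US.image (bdryPair₂ hd M)) := by
      rw [disjoint_left]
      intro y hy hy'
      obtain ⟨x, hx, rfl⟩ := mem_image.1 hy
      obtain ⟨x', hx', heq⟩ := mem_image.1 hy'
      exact bdryPair₁_ne_bdryPair₂ hd hb (hUsub hx) (hUsub hx') heq.symm
    calc 2 * #US = #(US.image (bdryPair₁ hd M)) + #(US.image (bdryPair₂ hd M)) := by rw [h1, h2]; ring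
      _ = #(US.image (bdryPair₁ hd M) ∪ US.image (bdryPair₂ hd M)) := (card_union_of_disjoint hdisj).symm
      _ ≤ #(ffBdryPairsNear d b M S) := card_le_card hsub
  omega

end Locality

/-! ### The Peierls condition -/

section Peierls

variable {b : ℕ}

/-- **The Peierls condition for the internal spins under decimation with spacing `b ≥ 2`, in
dimension `d ≥ 2`** (van Enter–Fernández–Sokal App. B.5.3, (B.73)–(B.77), with the constant `1/2`):
for frozen image spins with isolated `-` spins and any finite set `M` of internal sites,
`2 · #minusInc ≤ 2 · #plusInc + #ffBdryPairs`, i.e. `ΔE₋ - ΔE₊ ≤ J |Γ|` in (B.71), i.e.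
`H(ω_Γ | ω^{(+)}) = 2J|Γ| - ΔE₋ + ΔE₊ ≥ J|Γ|`. (The source states the Peierls constant
`2J(1 - M_{d,b})` and excludes `(d,b) = (2,2)`; for `b = 2` the statement here holds as well but is
empty of content for the alternating configuration, whose fields cancel exactly.) The hypothesis
`M ⊆` internal sites is not even needed for the inequality.
[cite: VanenterFernandezSokal1993, App. B.5.3 eqs. (B.71)–(B.77)] -/
theorem two_mul_card_minusInc_le (hd : 2 ≤ d) (hb : 2 ≤ b) {ξ : SpinConfig (Site d)}
    (hξ : MinusIsolated d b ξ) (M : Finset (Site d)) :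
    2 * #(minusInc d b ξ M) ≤ 2 * #(plusInc d b ξ M) + #(ffBdryPairs d b M) := by
  have h1 := card_pairedInc_add_card_unpairedInc hd ξ M (b := b)
  have h2 := card_pairedInc_le hd hb hξ M
  have h3 := two_mul_card_unpairedInc_le hd hb hξ M
  omega

/-- **The Peierls condition in terms of the image fields** `h^ξ_u = ∑_{a ∼ u image} ξ_a` of the
tree: `-∑_{u ∈ M} h^ξ_u ≤ #ffBdryPairs / 2` — the field energy released by turning the internal spins
of `M` to `-` inside `ω^{(+)}` is at most half the number of frustrated internal bonds created.
[cite: VanenterFernandezSokal1993, App. B.5.3 eqs. (B.71)–(B.77)] -/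
theorem sum_imgField_ge (hd : 2 ≤ d) (hb : 2 ≤ b) {ξ : SpinConfig (Site d)} (hξ : MinusIsolated d b ξ)
    (M : Finset (Site d)) :
    -(∑ u ∈ M, imgField d b ξ u) ≤ (#(ffBdryPairs d b M) : ℝ) / 2 := by
  rw [sum_imgField_eq]
  have h := two_mul_card_minusInc_le hd hb hξ M
  have h' : (2 : ℝ) * #(minusInc d b ξ M) ≤ 2 * #(plusInc d b ξ M) + #(ffBdryPairs d b M) := by
    exact_mod_cast h
  linarith

/-- **The Peierls condition for the systems of `VEFS1993_plusPhase`**: with all image spins of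
`Λ_{R'}` alternating (either parity `p`) and `+` elsewhere, for every finite set `M` of sites,
`-∑_{u ∈ M} h_u ≤ #ffBdryPairs / 2`. [cite: VanenterFernandezSokal1993, §4.3.2 and App. B.5.3] -/
theorem sum_imgField_signedCoreAnnulusBC_ge (hd : 2 ≤ d) (hb : 2 ≤ b) (p : ℤˣ) (R' : ℕ)
    (M : Finset (Site d)) :
    -(∑ u ∈ M, imgField d b (signedCoreAnnulusBC d b p R' R' 1 1) u) ≤ (#(ffBdryPairs d b M) : ℝ) / 2 :=
  sum_imgField_ge hd hb (minusIsolated_signedCoreAnnulusBC (by omega) p R') M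

end Peierls

/-! ### The Peierls condition as an energy bound: `H(ω_Γ | ω^{(+)}) ≥ |Γ|` (units `J = 1`) -/

section Energy

variable {b : ℕ}

variable (d b) in
/-- **The configuration `ω^{(+)}` with the image spins frozen to `ζ`**: `+1` at every internal
site, `ζ` at the image sites (App. B.5.3: "`ω^{(+)}` equal to `+1` everywhere", in terms of internal
spins). [cite: VanenterFernandezSokal1993, App. B.5.3 (p. 237)] -/
def plusFill (ζ : SpinConfig (Site d)) : SpinConfig (Site d) :=
  fun y => if IsSpImageSite d b y then ζ y else 1

/-- `ω^{(+)}` is `+1` at internal sites. [cite: VanenterFernandezSokal1993, App. B.5.3] -/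
theorem plusFill_of_not_isSpImageSite (ζ : SpinConfig (Site d)) {y : Site d} (hy : ¬ IsSpImageSite d b y) :
    plusFill d b ζ y = 1 := by
  simp [plusFill, hy]

/-- `ω^{(+)}` agrees with the frozen image spins at image sites. [cite: VanenterFernandezSokal1993, App. B.5.3] -/
theorem plusFill_of_isSpImageSite (ζ : SpinConfig (Site d)) {y : Site d} (hy : IsSpImageSite d b y) :
    plusFill d b ζ y = ζ y := by
  simp [plusFill, hy]

/-- The neighbours of a site of `M` outside `M` that are image sites are exactly its image
neighbours (`M` a set of internal sites). [cite: VanenterFernandezSokal1993, App. B.5.3] -/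
theorem outNbrs_filter_isSpImageSite {M : Finset (Site d)} (hM : ∀ u ∈ M, ¬ IsSpImageSite d b u)
    (y : Site d) :
    (outNbrs (zdGraph d) M y).filter (IsSpImageSite d b) = imgNbrs d b y := by
  ext z
  simp only [mem_filter, mem_outNbrs, mem_imgNbrs]
  constructor
  · rintro ⟨⟨hadj, -⟩, hz⟩; exact ⟨hadj, hz⟩
  · rintro ⟨hadj, hz⟩; exact ⟨⟨hadj, fun hzM => hM z hzM hz⟩, hz⟩

/-- **The boundary field of `ω^{(+)}` at a site of `M`**: the spins of `ω^{(+)}` summed over the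
neighbours outside `M` are (number of internal such neighbours) `+ h^ζ_y`.
[cite: VanenterFernandezSokal1993, App. B.5.3 eq. (B.71)] -/
theorem sum_outNbrs_spinAt_plusFill {M : Finset (Site d)} (hM : ∀ u ∈ M, ¬ IsSpImageSite d b u)
    (ζ : SpinConfig (Site d)) (y : Site d) :
    ∑ z ∈ outNbrs (zdGraph d) M y, spinAt z (plusFill d b ζ) =
      #((outNbrs (zdGraph d) M y).filter fun z => ¬ IsSpImageSite d b z) + imgField d b ζ y := by
  rw [← sum_filter_add_sum_filter_not (outNbrs (zdGraph d) M y) (fun z => ¬ IsSpImageSite d b z)]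
  congr 1
  · rw [card_eq_sum_ones, Nat.cast_sum, Nat.cast_one]
    refine sum_congr rfl fun z hz => ?_
    simp [spinAt, plusFill_of_not_isSpImageSite ζ (mem_filter.1 hz).2]
  · have hset : (outNbrs (zdGraph d) M y).filter (fun z => ¬¬ IsSpImageSite d b z) = imgNbrs d b y := by
      rw [← outNbrs_filter_isSpImageSite hM y]
      exact filter_congr fun z _ => not_not
    rw [hset, imgField]
    refine sum_congr rfl fun z hz => ?_
    simp [spinAt, plusFill_of_isSpImageSite ζ (mem_imgNbrs.1 hz).2]

/-- **`#ffBdryPairs` counted site by site**: `#ffBdryPairs M = ∑_{y ∈ M} #{z ∼ y : z ∉ M internal}`.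
[cite: VanenterFernandezSokal1993, App. B.5.3 (p. 236)] -/
theorem card_ffBdryPairs_eq_sum (M : Finset (Site d)) :
    #(ffBdryPairs d b M) = ∑ y ∈ M, #((outNbrs (zdGraph d) M y).filter fun z => ¬ IsSpImageSite d b z) := by
  rw [← card_sigma]
  refine card_bij (fun x _ => ⟨x.1, x.2⟩) ?_ ?_ ?_
  · intro x hx
    obtain ⟨h1, h2, h3, h4⟩ := mem_ffBdryPairs.1 hx
    exact mem_sigma.2 ⟨h1, mem_filter.2 ⟨(mem_outNbrs (zdGraph d)).2 ⟨h4, h2⟩, h3⟩⟩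
  · rintro ⟨y, z⟩ _ ⟨y', z'⟩ _ h
    simp only [Sigma.mk.inj_iff, heq_eq_eq] at h
    obtain ⟨rfl, rfl⟩ := h
    rfl
  · rintro ⟨y, z⟩ hyz
    obtain ⟨hy, hz⟩ := mem_sigma.1 hyz
    obtain ⟨hz, hint⟩ := mem_filter.1 hz
    obtain ⟨hadj, hzM⟩ := (mem_outNbrs (zdGraph d)).1 hz
    exact ⟨(y, z), mem_ffBdryPairs.2 ⟨hy, hzM, hint, hadj⟩, rfl⟩

/-- **The relative energy (B.71) of the flipped region**: for a set `M ⊆ Λ` of internal sites,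
`H^ζ_Λ(ω_Γ) - H^ζ_Λ(ω^{(+)}) = 2(|Γ| + ∑_{y ∈ M} h^ζ_y) = 2|Γ| - ΔE₋ + ΔE₊` (zero field, units
`J = 1`), where `ω_Γ` is `ω^{(+)}` with the spins of `M` turned to `-`.
[cite: VanenterFernandezSokal1993, App. B.5.3 eq. (B.71)] -/
theorem isingHamiltonian_flipOn_plusFill_sub {Λ M : Finset (Site d)} (hMΛ : M ⊆ Λ)
    (hM : ∀ u ∈ M, ¬ IsSpImageSite d b u) (ζ : SpinConfig (Site d)) :
    isingHamiltonian (zdGraph d) Λ 0 (.fixed ζ) (flipOn M (plusFill d b ζ)) -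
        isingHamiltonian (zdGraph d) Λ 0 (.fixed ζ) (plusFill d b ζ) =
      2 * (#(ffBdryPairs d b M) + ∑ y ∈ M, imgField d b ζ y) := by
  classical
  have hflip := isingHamiltonian_sub_isingHamiltonian_flipOn (zdGraph d) hMΛ 0 ζ (plusFill d b ζ)
  rw [sum_edgeBoundary_bondSpin] at hflip
  have hinner : ∑ y ∈ M, spinAt y (plusFill d b ζ) * ∑ z ∈ outNbrs (zdGraph d) M y, spinAt z (plusFill d b ζ) =
      #(ffBdryPairs d b M) + ∑ y ∈ M, imgField d b ζ y := by
    rw [card_ffBdryPairs_eq_sum, Nat.cast_sum, ← sum_add_distrib]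
    refine sum_congr rfl fun y hy => ?_
    rw [sum_outNbrs_spinAt_plusFill hM ζ y]
    simp [spinAt, plusFill_of_not_isSpImageSite ζ (hM y hy)]
  rw [hinner] at hflip
  linarith

/-- **The Peierls condition, energy form** (App. B.5.3, (B.71)–(B.77) with the constant `1/2`):
for frozen image spins `ζ` with isolated `-` spins — in particular the fully alternating
configuration, and the boundary conditions of `VEFS1993_plusPhase` — and every region `M ⊆ Λ` of
internal sites, turning the internal spins of `M` from `+` to `-` inside `ω^{(+)}` costs at least
the area of the internal-spin contour: `H^ζ_Λ(ω_Γ) - H^ζ_Λ(ω^{(+)}) ≥ |Γ| = #ffBdryPairs M`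
(zero field, units `J = 1`; the source's `ρ₀ ≥ 2J(1 - M_{d,b})` has `1 - M_{d,b}` in place of `1/2`).
In particular `ω^{(+)}` minimises the energy among configurations that differ from it on finitely
many internal sites ("the configurations `ω^{(+)}` and `ω^{(-)}` are indeed … ground-state
configurations"). [cite: VanenterFernandezSokal1993, App. B.5.3 eqs. (B.71)–(B.77)] -/
theorem card_ffBdryPairs_le_isingHamiltonian_flipOn_sub (hd : 2 ≤ d) (hb : 2 ≤ b)
    {ζ : SpinConfig (Site d)} (hζ : MinusIsolated d b ζ) {Λ M : Finset (Site d)} (hMΛ : M ⊆ Λ)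
    (hM : ∀ u ∈ M, ¬ IsSpImageSite d b u) :
    (#(ffBdryPairs d b M) : ℝ) ≤
      isingHamiltonian (zdGraph d) Λ 0 (.fixed ζ) (flipOn M (plusFill d b ζ)) -
        isingHamiltonian (zdGraph d) Λ 0 (.fixed ζ) (plusFill d b ζ) := by
  rw [isingHamiltonian_flipOn_plusFill_sub hMΛ hM ζ]
  have := sum_imgField_ge hd hb hζ M
  linarith

/-- In particular **`ω^{(+)}` is a ground state**: turning any finite set of internal spins of `Λ` to
`-` does not lower the energy ("the configurations `ω^{(+)}` and `ω^{(-)}` are indeed the only periodic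
ground-state configurations", App. B.5.3 p. 240; the `-` statement is the spin flip of this one for
the image configuration `-ζ`, which has isolated `-` spins as well when `ζ = p·ω'_alt`).
[cite: VanenterFernandezSokal1993, App. B.5.3 (p. 240)] -/
theorem isingHamiltonian_plusFill_le_flipOn (hd : 2 ≤ d) (hb : 2 ≤ b) {ζ : SpinConfig (Site d)}
    (hζ : MinusIsolated d b ζ) {Λ M : Finset (Site d)} (hMΛ : M ⊆ Λ) (hM : ∀ u ∈ M, ¬ IsSpImageSite d b u) :
    isingHamiltonian (zdGraph d) Λ 0 (.fixed ζ) (plusFill d b ζ) ≤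
      isingHamiltonian (zdGraph d) Λ 0 (.fixed ζ) (flipOn M (plusFill d b ζ)) := by
  have h := card_ffBdryPairs_le_isingHamiltonian_flipOn_sub hd hb hζ hMΛ hM
  have h0 : (0 : ℝ) ≤ #(ffBdryPairs d b M) := Nat.cast_nonneg _
  linarith

/-- The energy form for the systems of `VEFS1993_plusPhase` (all image spins of `Λ_{R'}`
alternating, either parity, `+` elsewhere). [cite: VanenterFernandezSokal1993, §4.3.2 and App. B.5.3] -/
theorem card_ffBdryPairs_le_isingHamiltonian_flipOn_sub_signedCoreAnnulusBC (hd : 2 ≤ d) (hb : 2 ≤ b)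
    (p : ℤˣ) (R' : ℕ) {Λ M : Finset (Site d)} (hMΛ : M ⊆ Λ) (hM : ∀ u ∈ M, ¬ IsSpImageSite d b u) :
    (#(ffBdryPairs d b M) : ℝ) ≤
      isingHamiltonian (zdGraph d) Λ 0 (.fixed (signedCoreAnnulusBC d b p R' R' 1 1))
          (flipOn M (plusFill d b (signedCoreAnnulusBC d b p R' R' 1 1))) -
        isingHamiltonian (zdGraph d) Λ 0 (.fixed (signedCoreAnnulusBC d b p R' R' 1 1))
          (plusFill d b (signedCoreAnnulusBC d b p R' R' 1 1)) :=
  card_ffBdryPairs_le_isingHamiltonian_flipOn_sub hd hb (minusIsolated_signedCoreAnnulusBC (by omega) p R')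
    hMΛ hM

end Energy

end Literature.Barriers.CriticalPhenomena.NonGibbs

end
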